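import Summits.AtomisticToContinuum.BoseEinsteinCondensation.Theorems.BECInsertionCorrectorCorrectorClosureTiltCorrectorAux
import Literature.MathematicalPhysics.QuantumManyBody.InsertionStateIdentities
import HarnessLib

/-!
# The tilt family of weak corrector identities, II: bounded pair potentials, Fubini on the cell and
# the lift of the `N`-body Euler–Lagrange equation to `(ℝ³)^{N+1}`
# (line `geometric-mean-corrector`, helpers for stub S4 `stub_tiltCorrector`, crux
# `BECInsertionCorrector.CorrectorClosure`, item stmt-AtomisticToContinuum-12058)

Supports (does not close) stmt-AtomisticToContinuum-12058. Content:

* for a bounded periodisation `w^per ≤ C` (so that every term is finite,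
  `periodicInteraction_le_of_bounded`) the split of the real pair sum at the tagged particle,
  `V_{N+1}(Z) = ∑_{j≥1} w^per(z₀ − zⱼ) + V_N(tail Z)` (`tilt_toReal_periodicInteraction_succ`, from
  `periodicInteraction_succ`);
* `tilt_setIntegral_cellN_succ_left`: Fubini `∫_{cell^{N+1}} G = ∫_cell ∫_{cell^N} G(x₀, Y) dY dx₀`
  for an INTEGRABLE real `G` (the continuous case is `setIntegral_cellN_succ_left_of_continuous`);
* `tilt_el_tail`: for the bath amplitude `a = |Θ∘tail|` of a real ground state `Θ` of `N` bosons,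
  `∫ ∇a·∇(ζa) + ∫ V_N(tail) ζ a² = E₀(N) ∫ ζ a²` over `cell^{N+1}` for every lattice-periodic `C¹`
  `ζ` on `(ℝ³)^{N+1}` (Fubini, and the `N`-body equation `tilt_el_all` on each slice `ζ(x₀, ·)`).

References: [ReedSimonIV1978] §XIII.1 (Rayleigh–Ritz).
-/

noncomputable section

namespace Summit.AtomisticToContinuum.BoseEinsteinCondensation.Theorems.CorrectorClosure.GeometricMeanCorrector

open MeasureTheory Filter
open scoped ENNReal NNReal ComplexConjugate BigOperators
open Literature.MathematicalPhysics.QuantumManyBody.BoseGas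
open Summit.AtomisticToContinuum.BoseEinsteinCondensation.Cruxes.StaticResponseBound.UvThomsonForceWave
  (contDiff_norm_of_real measurable_periodicInteraction_of)

/-! ### Bounded potentials: finiteness and the split of the pair sum at the tagged particle -/

section Potential

variable {N : ℕ} {L : ℝ} {w : ℝ → ℝ≥0∞}

/-- **Splitting the real pair sum at the tagged particle `0`** (bounded periodisation, so that all
terms are finite): `V_{N+1}(Z) = ∑_{j ≥ 1} w^per(z₀ - zⱼ) + V_N(tail Z)` in `ℝ`. [folklore] -/
theorem tilt_toReal_periodicInteraction_succ {C : ℝ≥0} (hC : ∀ x, periodizedPotential w L x ≤ C)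
    (Z : Config (N + 1)) :
    (periodicInteraction w L Z).toReal =
      (∑ j : Fin N, (periodizedPotential w L (Z 0 - Z j.succ)).toReal) +
        (periodicInteraction w L (Fin.tail Z)).toReal := by
  have hne : ∀ x, periodizedPotential w L x ≠ ⊤ := fun x =>
    ne_top_of_le_ne_top ENNReal.coe_ne_top (hC x)
  have hVne : ∀ Y : Config N, periodicInteraction w L Y ≠ ⊤ := fun Y =>
    ne_top_of_le_ne_top (ENNReal.mul_ne_top (ENNReal.natCast_ne_top _) ENNReal.coe_ne_top)
      (periodicInteraction_le_of_bounded hC Y)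
  rw [periodicInteraction_succ, ENNReal.toReal_add (ENNReal.sum_ne_top.2 fun j _ => hne _) (hVne _),
    ENNReal.toReal_sum fun j _ => hne _]
  rfl

end Potential

/-! ### Fubini on the cell and the lift of the `N`-body equation to `(ℝ³)^{N+1}` -/

section Lift

variable {N : ℕ} {L : ℝ} {w : ℝ → ℝ≥0∞}

/-- **Fubini on the cell for an integrable real function, tagged coordinate outermost**:
`∫_{[0,L)^{3(N+1)}} G = ∫_{[0,L)³} (∫_{[0,L)^{3N}} G(x₀, Y) dY) dx₀`. [folklore] -/
theorem tilt_setIntegral_cellN_succ_left {G : Config (N + 1) → ℝ}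
    (hG : IntegrableOn G (cellN (N + 1) L)) :
    ∫ X in cellN (N + 1) L, G X = ∫ x in cell L, ∫ Y in cellN N L, G (Matrix.vecCons x Y) := by
  -- adapted from `setIntegral_cellN_succ_left_of_continuous` (InsertionStateIdentities)
  have hint : Integrable (fun p : Space × Config N => G (Matrix.vecCons p.1 p.2))
      ((volume.restrict (cell L)).prod (volume.restrict (cellN N L))) := by
    have h := ((measurePreserving_vecCons (n := N)).integrableOn_comp_preimage
      measurableEmbedding_vecCons (f := G) (s := cellN (N + 1) L)).2 hG
    rw [vecCons_preimage_cellN] at h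
    rw [Measure.prod_restrict]
    exact h
  calc ∫ X in cellN (N + 1) L, G X
      = ∫ p in (fun p : Space × Config N => (Matrix.vecCons p.1 p.2 : Config (N + 1))) ⁻¹'
            cellN (N + 1) L, G (Matrix.vecCons p.1 p.2) ∂(volume.prod volume) :=
        ((measurePreserving_vecCons (n := N)).setIntegral_preimage_emb
          measurableEmbedding_vecCons G _).symm
    _ = ∫ p, G (Matrix.vecCons p.1 p.2)
          ∂((volume.restrict (cell L)).prod (volume.restrict (cellN N L))) := by
        rw [vecCons_preimage_cellN, Measure.prod_restrict]
    _ = ∫ x in cell L, ∫ Y in cellN N L, G (Matrix.vecCons x Y) :=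
        integral_prod (fun p : Space × Config N => G (Matrix.vecCons p.1 p.2)) hint

/-- **The `N`-body Euler–Lagrange equation lifted to `(ℝ³)^{N+1}`.** For a measurable profile `w`
with bounded periodisation and a real nonnegative finite-energy periodic ground state `Θ` of `N`
bosons, the bath amplitude `a(Z) = |Θ(tail Z)|` satisfies, for every lattice-periodic `C¹` test
function `ζ` on `(ℝ³)^{N+1}`,
`∫ ∇a·∇(ζa) + ∫ V_N(tail Z) ζ a² = E₀(N) ∫ ζ a²` over `[0,L)^{3(N+1)}`: Fubini with the tagged
coordinate `z₀` outermost, and for each frozen `z₀` the `N`-body equation (`tilt_el_all`) tested on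
the slice `ζ(z₀, ·)` (`∂_0 a = 0`, `∂_{j+1}(ζa)(z₀, Y) = ∂_j(ζ(z₀,·)|Θ|)(Y)`). [cite: ReedSimonIV1978, §XIII.1 (Rayleigh–Ritz)] -/
theorem tilt_el_tail {N : ℕ} {L : ℝ} {w : ℝ → ℝ≥0∞} (hw : Measurable w) {C : ℝ≥0}
    (hC : ∀ x, periodizedPotential w L x ≤ C) (Θ : PeriodicTrialState N L)
    (hreal : ∀ X, Θ.ψ X = (‖Θ.ψ X‖ : ℂ))
    (hE : periodicEnergy w Θ = periodicGroundStateEnergy w N L) (hfin : periodicEnergy w Θ ≠ ⊤)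
    {ζ : Config (N + 1) → ℝ} (hζ : ContDiff ℝ 1 ζ) (hζper : IsLatticePeriodic L ζ) :
    (∫ Z in cellN (N + 1) L, gradDot (fun W => ‖Θ.ψ (Fin.tail W)‖)
        (fun W => ζ W * ‖Θ.ψ (Fin.tail W)‖) Z) +
      (∫ Z in cellN (N + 1) L,
        (periodicInteraction w L (Fin.tail Z)).toReal * ζ Z * ‖Θ.ψ (Fin.tail Z)‖ ^ 2) =
    (periodicEnergy w Θ).toReal * ∫ Z in cellN (N + 1) L, ζ Z * ‖Θ.ψ (Fin.tail Z)‖ ^ 2 := by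
  obtain ⟨F, hFdef⟩ : ∃ F : Config N → ℝ, F = fun Y => ‖Θ.ψ Y‖ := ⟨_, rfl⟩
  obtain ⟨U, hUdef⟩ : ∃ U : Config N → ℝ, U = fun X => (periodicInteraction w L X).toReal :=
    ⟨_, rfl⟩
  have hF' : ∀ Y, ‖Θ.ψ Y‖ = F Y := fun Y => by rw [hFdef]
  have hU' : ∀ X, (periodicInteraction w L X).toReal = U X := fun X => by rw [hUdef]
  set E : ℝ := (periodicEnergy w Θ).toReal with hEdef
  have hF : ContDiff ℝ 1 F := by rw [hFdef]; exact contDiff_norm_of_real Θ hreal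
  have hFd : Differentiable ℝ F := hF.differentiable one_ne_zero
  have hζd : Differentiable ℝ ζ := hζ.differentiable one_ne_zero
  have hUbd : ∀ Y, |U Y| ≤ ((N * N : ℕ) : ℝ) * C := fun Y => by
    rw [hUdef, abs_of_nonneg ENNReal.toReal_nonneg]
    have h := ENNReal.toReal_mono (ENNReal.mul_ne_top (ENNReal.natCast_ne_top _) ENNReal.coe_ne_top)
      (periodicInteraction_le_of_bounded hC Y)
    rwa [ENNReal.toReal_mul, ENNReal.toReal_natCast, ENNReal.coe_toReal] at h
  have hUm : Measurable U := by
    rw [hUdef]; exact (measurable_periodicInteraction_of hw L).ennreal_toReal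
  -- the `N`-body equation on every slice `ζ(x, ·)`
  have hELN : ∀ x : Space,
      (∫ Y in cellN N L, gradDot F (fun W => ζ (Matrix.vecCons x W) * F W) Y) +
        (∫ Y in cellN N L, U Y * ζ (Matrix.vecCons x Y) * F Y ^ 2) =
      E * ∫ Y in cellN N L, ζ (Matrix.vecCons x Y) * F Y ^ 2 := by
    intro x
    have hζx : ContDiff ℝ 1 fun W : Config N => ζ (Matrix.vecCons x W) :=
      hζ.comp (contDiff_vecCons_right x)
    have hζxper : IsLatticePeriodic L fun W : Config N => ζ (Matrix.vecCons x W) := by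
      intro Y j k
      show ζ (Matrix.vecCons x (Y + Pi.single j (EuclideanSpace.single k L))) =
        ζ (Matrix.vecCons x Y)
      rw [vecCons_add_single, hζper]
    have h := tilt_el_all hw hreal hE hfin hζx hζxper
    simp only [hF', hU'] at h
    exact h
  simp only [hF', hU']
  -- integrability on `cell^{N+1}`
  have haC : ContDiff ℝ 1 fun W : Config (N + 1) => F (Fin.tail W) := tilt_contDiff_comp_tail hF
  have had : Differentiable ℝ fun W : Config (N + 1) => F (Fin.tail W) :=
    haC.differentiable one_ne_zero
  have i1 : IntegrableOn (fun Z => gradDot (fun W => F (Fin.tail W))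
      (fun W => ζ W * F (Fin.tail W)) Z) (cellN (N + 1) L) :=
    integrableOn_cellN (continuous_gradDot haC (hζ.mul haC)) L
  have i3 : IntegrableOn (fun Z => ζ Z * F (Fin.tail Z) ^ 2) (cellN (N + 1) L) :=
    integrableOn_cellN (hζ.continuous.mul (haC.continuous.pow 2)) L
  have i2 : IntegrableOn (fun Z => U (Fin.tail Z) * (ζ Z * F (Fin.tail Z) ^ 2)) (cellN (N + 1) L) := by
    refine Integrable.bdd_mul (c := ((N * N : ℕ) : ℝ) * C) i3 ?_ (ae_of_all _ fun Z => ?_)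
    · exact (hUm.comp (measurable_pi_lambda _ fun j => measurable_pi_apply (Fin.succ j))).aestronglyMeasurable
    · rw [Real.norm_eq_abs]; exact hUbd _
  -- the combined integrand and its vanishing integral (slice by slice)
  set G : Config (N + 1) → ℝ := fun Z =>
    gradDot (fun W => F (Fin.tail W)) (fun W => ζ W * F (Fin.tail W)) Z +
      U (Fin.tail Z) * (ζ Z * F (Fin.tail Z) ^ 2) - E * (ζ Z * F (Fin.tail Z) ^ 2) with hGdef
  have hGint : IntegrableOn G (cellN (N + 1) L) := (i1.add i2).sub (i3.const_mul E)
  have hG0 : ∫ Z in cellN (N + 1) L, G Z = 0 := by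
    rw [tilt_setIntegral_cellN_succ_left hGint]
    refine integral_eq_zero_of_ae (ae_of_all _ fun x => ?_)
    have hζx : ContDiff ℝ 1 fun W : Config N => ζ (Matrix.vecCons x W) :=
      hζ.comp (contDiff_vecCons_right x)
    have hGd : Differentiable ℝ fun W : Config (N + 1) => ζ W * F (Fin.tail W) := hζd.mul had
    have hpt : ∀ Y, G (Matrix.vecCons x Y) =
        gradDot F (fun W => ζ (Matrix.vecCons x W) * F W) Y +
          U Y * (ζ (Matrix.vecCons x Y) * F Y ^ 2) - E * (ζ (Matrix.vecCons x Y) * F Y ^ 2) := by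
      intro Y
      simp only [hGdef, mixedLaw_tail_vecCons]
      rw [tilt_gradDot_tail_vecCons hFd hGd x Y]
      simp only [mixedLaw_tail_vecCons]
    have j1 : IntegrableOn (fun Y => gradDot F (fun W => ζ (Matrix.vecCons x W) * F W) Y)
        (cellN N L) :=
      integrableOn_cellN (continuous_gradDot hF (hζx.mul hF)) L
    have j3 : IntegrableOn (fun Y => ζ (Matrix.vecCons x Y) * F Y ^ 2) (cellN N L) :=
      integrableOn_cellN (hζx.continuous.mul (hF.continuous.pow 2)) L
    have j2 : IntegrableOn (fun Y => U Y * (ζ (Matrix.vecCons x Y) * F Y ^ 2)) (cellN N L) :=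
      Integrable.bdd_mul (c := ((N * N : ℕ) : ℝ) * C) j3 hUm.aestronglyMeasurable
        (ae_of_all _ fun Y => by rw [Real.norm_eq_abs]; exact hUbd Y)
    have e2 : ∫ Y in cellN N L, U Y * (ζ (Matrix.vecCons x Y) * F Y ^ 2) =
        ∫ Y in cellN N L, U Y * ζ (Matrix.vecCons x Y) * F Y ^ 2 :=
      integral_congr_ae (ae_of_all _ fun Y => by ring)
    have j12 : IntegrableOn (fun Y => gradDot F (fun W => ζ (Matrix.vecCons x W) * F W) Y +
        U Y * (ζ (Matrix.vecCons x Y) * F Y ^ 2)) (cellN N L) := j1.add j2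
    have j3E : IntegrableOn (fun Y => E * (ζ (Matrix.vecCons x Y) * F Y ^ 2)) (cellN N L) :=
      j3.const_mul E
    show ∫ Y in cellN N L, G (Matrix.vecCons x Y) = 0
    simp_rw [hpt]
    rw [integral_sub j12 j3E, integral_add j1 j2, integral_const_mul, e2, hELN x, sub_self]
  -- split `∫ G = 0` into the three terms
  have hsplit : ∫ Z in cellN (N + 1) L, G Z =
      (∫ Z in cellN (N + 1) L, gradDot (fun W => F (Fin.tail W))
          (fun W => ζ W * F (Fin.tail W)) Z) +
        (∫ Z in cellN (N + 1) L, U (Fin.tail Z) * (ζ Z * F (Fin.tail Z) ^ 2)) -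
        E * ∫ Z in cellN (N + 1) L, ζ Z * F (Fin.tail Z) ^ 2 := by
    have i12 : IntegrableOn (fun Z => gradDot (fun W => F (Fin.tail W))
        (fun W => ζ W * F (Fin.tail W)) Z + U (Fin.tail Z) * (ζ Z * F (Fin.tail Z) ^ 2))
        (cellN (N + 1) L) := i1.add i2
    have i3E : IntegrableOn (fun Z => E * (ζ Z * F (Fin.tail Z) ^ 2)) (cellN (N + 1) L) :=
      i3.const_mul E
    simp only [hGdef]
    rw [integral_sub i12 i3E, integral_add i1 i2, integral_const_mul]
  have e2 : ∫ Z in cellN (N + 1) L, U (Fin.tail Z) * ζ Z * F (Fin.tail Z) ^ 2 =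
      ∫ Z in cellN (N + 1) L, U (Fin.tail Z) * (ζ Z * F (Fin.tail Z) ^ 2) :=
    integral_congr_ae (ae_of_all _ fun Z => by ring)
  rw [e2]
  linarith [hsplit, hG0]

end Lift

end Summit.AtomisticToContinuum.BoseEinsteinCondensation.Theorems.CorrectorClosure.GeometricMeanCorrector

end
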